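import Summits.KontsevichZagierPeriods.KontsevichZagierPeriods.Theorems.SoloBlindCauchyStokesA
import HarnessLib

/-!
# Green's formula on the half-plane inside the rules, I: the datum

Files `SoloBlindCauchy*` ran Green's formula for ONE form `(z(1-z))^e dz` on the half-plane
`D = {x < ½, y > 0}` inside Kontsevich–Zagier's three rules.  Here the argument is made GENERIC:
a `GreenDatum` is a function `g`, complex-differentiable on `{x ≤ ½, y > 0}` with derivative `g'`,
continuous from the closed upper half-plane at the boundary points `(x, 0)`, `x < ½`, `x ≠ 0`,
whose real coordinates `P = Re g`, `Q = Im g`, `h = Re g' = ∂P/∂x = ∂Q/∂y` are `ℚ`-semialgebraic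
on the closed half-plane `Eup`, with `h ∈ L¹(D)`, `g → 0` along the fibres `y → ∞` and `x → -∞`,
and with integrable traces `P(½, ·)` on `(0, ∞)` and `Q(·, 0)` on `baseA = (-∞,0) ∪ (0,½)`.
For such a datum the two Newton–Leibniz routes of `∬_D h` give (files `SoloBlindGreenB`,
`SoloBlindGreenA`)

  `[(0,∞), P(½,y)] ≡ [D, h] ≡ [baseA, -Q(x,0)]`,

i.e. the imaginary part of Cauchy's theorem `∮_{∂D} g dz = 0`, as an identity in the
Kontsevich–Zagier period algebra.  This file: the structure, the Cauchy–Riemann partials, the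
three representations, and the continuity lemma at a compactified end (now from a plain limit).

References: Kontsevich–Zagier, *Periods* (2001), §1.2; Whittaker–Watson, *Modern Analysis*, §12.41.
-/

noncomputable section

open Set Complex MeasureTheory Filter
open scoped Topology
open Literature.ModelTheory.ExponentialFields MvPolynomial
open Literature.NumberTheory.Transcendental
open Literature.NumberTheory.Transcendental.KZ

namespace Summit.KontsevichZagierPeriods.KontsevichZagierPeriods.Theorems

namespace SoloBlind

/-- **A Green datum on the half-plane `D = {x < ½, y > 0}`.** -/
structure GreenDatum where
  /-- the holomorphic function -/
  g : ℂ → ℂ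
  /-- its complex derivative -/
  g' : ℂ → ℂ
  hasDerivAt : ∀ x y : ℝ, x ≤ 1 / 2 → 0 < y → HasDerivAt g (g' (x + y * I)) (x + y * I)
  cwa : ∀ x : ℝ, x < 1 / 2 → x ≠ 0 → ContinuousWithinAt (fun y : ℝ => g (x + y * I)) (Ici 0) 0
  sa_re : IsSemialgebraicFunOn ℚ Eup fun z => (g ((z 0 : ℂ) + z 1 * I)).re
  sa_im : IsSemialgebraicFunOn ℚ Eup fun z => (g ((z 0 : ℂ) + z 1 * I)).im
  sa_h : IsSemialgebraicFunOn ℚ Eup fun z => (g' ((z 0 : ℂ) + z 1 * I)).re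
  integrableOn_h : IntegrableOn (fun z : Fin 2 → ℝ => (g' ((z 0 : ℂ) + z 1 * I)).re) Dom
  tendsto_atTop : ∀ x : ℝ, x < 1 / 2 → Tendsto (fun y : ℝ => g (x + y * I)) atTop (𝓝 0)
  tendsto_atBot : ∀ y : ℝ, 0 < y → Tendsto (fun x : ℝ => g (x + y * I)) atBot (𝓝 0)
  integrableOn_mid : IntegrableOn (fun y : ℝ => (g (((1 / 2 : ℝ) : ℂ) + y * I)).re) (Ioi 0)
  integrableOn_edge : IntegrableOn (fun x : ℝ => (g ((x : ℂ) + ((0 : ℝ) : ℂ) * I)).im) baseA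

namespace GreenDatum

variable (D : GreenDatum)

/-! ## The real coordinates `P`, `Q`, `h` -/

/-- `P(x,y) = Re g(x+iy)`. -/
def P (z : Fin 2 → ℝ) : ℝ := (D.g ((z 0 : ℂ) + z 1 * I)).re

/-- `Q(x,y) = Im g(x+iy)`. -/
def Q (z : Fin 2 → ℝ) : ℝ := (D.g ((z 0 : ℂ) + z 1 * I)).im

/-- `h(x,y) = Re g'(x+iy) = ∂P/∂x = ∂Q/∂y`. -/
def H (z : Fin 2 → ℝ) : ℝ := (D.g' ((z 0 : ℂ) + z 1 * I)).re

/-- The values in Cartesian form. -/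
theorem PQH_apply (x y : ℝ) :
    D.P ![x, y] = (D.g (x + y * I)).re ∧ D.Q ![x, y] = (D.g (x + y * I)).im ∧
      D.H ![x, y] = (D.g' (x + y * I)).re := by
  simp [P, Q, H]

/-! ## Cauchy–Riemann -/

/-- `∂/∂x Re g(x+iy) = Re g'(x+iy)`. -/
theorem hasDerivAt_re_dx {x y : ℝ} (hx : x ≤ 1 / 2) (hy : 0 < y) :
    HasDerivAt (fun s : ℝ => (D.g (s + y * I)).re) (D.g' (x + y * I)).re x := by
  have hin : HasDerivAt (fun s : ℂ => s + y * I) 1 (x : ℂ) := by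
    simpa using (hasDerivAt_id (x : ℂ)).add_const ((y : ℂ) * I)
  have hcomp : HasDerivAt (D.g ∘ fun s : ℂ => s + y * I) (D.g' (x + y * I) * 1) (x : ℂ) :=
    HasDerivAt.comp (x : ℂ) (D.hasDerivAt x y hx hy) hin
  have h := hcomp.real_of_complex
  rw [mul_one] at h
  exact h

/-- `∂/∂y Im g(x+iy) = Re g'(x+iy)`. -/
theorem hasDerivAt_im_dy {x y : ℝ} (hx : x ≤ 1 / 2) (hy : 0 < y) :
    HasDerivAt (fun s : ℝ => (D.g (x + s * I)).im) (D.g' (x + y * I)).re y := by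
  have hin : HasDerivAt (fun s : ℂ => (x : ℂ) + s * I) I (y : ℂ) := by
    simpa using ((hasDerivAt_id (y : ℂ)).mul_const I).const_add (x : ℂ)
  have hcomp : HasDerivAt (fun s : ℂ => -I * (D.g ∘ fun s : ℂ => (x : ℂ) + s * I) s)
      (-I * (D.g' (x + y * I) * I)) (y : ℂ) :=
    (HasDerivAt.comp (y : ℂ) (D.hasDerivAt x y hx hy) hin).const_mul (-I)
  have h := hcomp.real_of_complex
  have hfun : (fun s : ℝ => (D.g (x + s * I)).im) =
      fun s : ℝ => (-I * (D.g ∘ fun s : ℂ => (x : ℂ) + s * I) s).re := by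
    funext s; simp
  rw [hfun, show (D.g' (x + y * I)).re = (-I * (D.g' (x + y * I) * I)).re by simp]
  exact h

/-- Continuity of `s ↦ g(s+iy)` at `x ≤ ½` (`y > 0`). -/
theorem continuousAt_dx {x y : ℝ} (hx : x ≤ 1 / 2) (hy : 0 < y) :
    ContinuousAt (fun s : ℝ => D.g (s + y * I)) x :=
  ContinuousAt.comp (f := fun s : ℝ => (s : ℂ) + y * I) (D.hasDerivAt x y hx hy).continuousAt
    (by fun_prop)

/-- Continuity of `s ↦ g(x+is)` at `y > 0` (`x ≤ ½`). -/
theorem continuousAt_dy {x y : ℝ} (hx : x ≤ 1 / 2) (hy : 0 < y) :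
    ContinuousAt (fun s : ℝ => D.g (x + s * I)) y :=
  ContinuousAt.comp (f := fun s : ℝ => (x : ℂ) + s * I) (D.hasDerivAt x y hx hy).continuousAt
    (by fun_prop)

/-! ## The compactified end -/

/-- `m(t) = t/(1-t) → +∞` as `t → 1⁻`. -/
theorem tendsto_moeb_one : Tendsto moeb (𝓝[<] (1 : ℝ)) atTop := by
  have h1 : Tendsto (fun t : ℝ => 1 - t) (𝓝[<] (1 : ℝ)) (𝓝[>] (0 : ℝ)) := by
    refine tendsto_nhdsWithin_iff.mpr ⟨?_, ?_⟩
    · have : Tendsto (fun t : ℝ => 1 - t) (𝓝 1) (𝓝 (1 - 1)) :=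
        ((continuous_const.sub continuous_id).tendsto 1)
      rw [sub_self] at this
      exact this.mono_left nhdsWithin_le_nhds
    · filter_upwards [self_mem_nhdsWithin] with t ht
      exact sub_pos.mpr (mem_Iio.mp ht)
  have h2 : Tendsto (fun t : ℝ => (1 - t)⁻¹) (𝓝[<] (1 : ℝ)) atTop :=
    tendsto_inv_nhdsGT_zero.comp h1
  have h3 : Tendsto (fun t : ℝ => (1 - t)⁻¹ + (-1)) (𝓝[<] (1 : ℝ)) atTop :=
    tendsto_atTop_add_const_right _ _ h2
  refine h3.congr' ?_
  filter_upwards [self_mem_nhdsWithin] with t ht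
  have h : (1 : ℝ) - t ≠ 0 := sub_ne_zero.mpr (ne_of_gt (mem_Iio.mp ht))
  rw [moeb]
  field_simp
  ring

/-- **Continuity at the compactified end**, limit form: a function continuous on `[0,1)`,
vanishing at `1`, and tending to `0` at `1⁻` is continuous on `[0,1]`. -/
theorem continuousOn_Icc_of_tendsto {G : ℝ → ℝ} (hG : ContinuousOn G (Ico 0 1)) (h1 : G 1 = 0)
    (hlim : Tendsto G (𝓝[<] 1) (𝓝 0)) : ContinuousOn G (Icc 0 1) := by
  intro t ht
  rcases ht.2.lt_or_eq with hlt | rfl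
  · refine (hG t ⟨ht.1, hlt⟩).mono_of_mem_nhdsWithin ?_
    exact mem_nhdsWithin.mpr ⟨Iio 1, isOpen_Iio, hlt, fun s ⟨hs1, hs2⟩ => ⟨hs2.1, hs1⟩⟩
  · rw [continuousWithinAt_Icc_iff_Iic zero_lt_one, ← continuousWithinAt_Iio_iff_Iic,
      ContinuousWithinAt, h1]
    exact hlim

/-! ## The three representations -/

/-- **`[D, h]`**, the absolutely convergent surface term. -/
def rep : IntegralRep 2 where
  domain := Dom
  integrand := D.H
  isSemialgebraic_domain := isSemialgebraic_Dom
  isSemialgebraicFunOn_integrand := D.sa_h.mono Dom_subset_Eup isSemialgebraic_Dom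
  integrableOn := D.integrableOn_h

/-- The trace `y ↦ P(½, y)` on the axis `x = ½`. -/
def mid (y : ℝ) : ℝ := D.P ![1 / 2, y]

/-- The trace `x ↦ -Q(x, 0)` on the real axis. -/
def edge (x : ℝ) : ℝ := -D.Q ![x, 0]

/-- `mid` is `ℚ`-semialgebraic on `(0,∞)`. -/
theorem sa_mid : IsSemialgebraicFunOn ℚ (line (Ioi 0)) (fun x => D.mid (x 0)) := by
  have hS : IsSemialgebraic ℚ (line (Ioi (0 : ℝ))) := isSemialgebraic_line_Ioi isAlgebraic_zero
  have hmap : IsSemialgebraicMapOn ℚ (line (Ioi (0 : ℝ)))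
      (fun x : Fin 1 → ℝ => (![1 / 2, x 0] : Fin 2 → ℝ)) := by
    refine IsSemialgebraicMapOn.of_forall hS fun j => ?_
    fin_cases j
    · exact (isSemialgebraicFunOn_const_ratCast hS (1 / 2 : ℚ)).congr fun x _ => by simp
    · exact (isSemialgebraicFunOn_aeval hS (X 0)).congr fun x _ => by simp
  have hto : MapsTo (fun x : Fin 1 → ℝ => (![1 / 2, x 0] : Fin 2 → ℝ)) (line (Ioi 0)) Eup := by
    intro x hx
    have hx' : 0 < x 0 := hx
    refine ⟨?_, ?_, Or.inl ?_⟩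
    · simpa using hx'.le
    · simp
    · simpa using hx'
  exact (D.sa_re.comp_isSemialgebraicMapOn_holds hmap hto).congr fun _ _ => rfl

/-- `edge` is `ℚ`-semialgebraic on `baseA`. -/
theorem sa_edge : IsSemialgebraicFunOn ℚ (line baseA) (fun x => D.edge (x 0)) := by
  have hmap : IsSemialgebraicMapOn ℚ (line baseA)
      (fun x : Fin 1 → ℝ => (![x 0, 0] : Fin 2 → ℝ)) := by
    refine IsSemialgebraicMapOn.of_forall isSemialgebraic_line_baseA fun j => ?_
    fin_cases j
    · exact (isSemialgebraicFunOn_aeval isSemialgebraic_line_baseA (X 0)).congr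
        fun x _ => by simp
    · exact (isSemialgebraicFunOn_aeval isSemialgebraic_line_baseA
        (0 : MvPolynomial (Fin 1) ℚ)).congr fun x _ => by simp
  have hto : MapsTo (fun x : Fin 1 → ℝ => (![x 0, 0] : Fin 2 → ℝ)) (line baseA) Eup := by
    intro x hx
    have hx' : x 0 < 1 / 2 ∧ x 0 ≠ 0 := hx
    refine ⟨?_, ?_, Or.inr ?_⟩
    · simp
    · simpa using hx'.1.le
    · simpa using hx'.2
  exact (D.sa_im.comp_isSemialgebraicMapOn_holds hmap hto).fun_neg.congr fun _ _ => rfl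

/-- **`[(0,∞), P(½, y)]`**, the trace on the axis of the half-plane. -/
def midRep : IntegralRep 1 :=
  lineRep (Ioi 0) D.mid (isSemialgebraic_line_Ioi isAlgebraic_zero) D.sa_mid
    (D.integrableOn_mid.congr (Eventually.of_forall fun y => by simp [mid, P]))

/-- **`[baseA, -Q(x, 0)]`**, the trace on the real edge. -/
def edgeRep : IntegralRep 1 :=
  lineRep baseA D.edge isSemialgebraic_line_baseA D.sa_edge
    (D.integrableOn_edge.neg.congr (Eventually.of_forall fun x => by simp [edge, Q]))

end GreenDatum

end SoloBlind

end Summit.KontsevichZagierPeriods.KontsevichZagierPeriods.Theorems
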